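import Summits.MatrixMultiplication.OmegaCensus.STPPVosperCoverExtract
import Summits.MatrixMultiplication.OmegaCensus.STPPVosperSlackOneTwoRuns
import Summits.MatrixMultiplication.OmegaCensus.STPPDisjointPacking
import Summits.MatrixMultiplication.OmegaCensus.STPP222SqSymmetry

/-!
# ω-census (abelian STPP census): steps for the slack-1 cover law — progression complements, holed sums, the case-α₂ cover table, index descriptions (kernel)

HONEST FRAMING (pub-omega census; verbatim): lottery ticket; floor = certified bounds/negative ranges.
Census STRUCTURE (seat pub-omega-stpp-2 gen 25, 2026-08-28), family (b2).  Helper steps for `no_isSTPP_of_slack_one_cover_prime_a2`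
(`STPPVosperSlackOneCoverLawA2.lean`): §1 the complement of a progression in `ℤ/pℤ` (`sdiff_univ_apFinset`), the missing point of an almost-full subset,
the INTERIOR-TERMS lemma for the sum of two one-holed progressions (`mem_add_of_apErase_apErase`: every term of index `2 ≤ x ≤ b+n−2` of the
`(b+n+1)`-term progression is attained, so only an end or next-to-end term can be missing), and the two-run value list; §2 the case-α₂ row checker WITH
the cover search attached to each surviving row (`alpha2RowOK`, one `(j, ℓ₁)` per call, both search orders, meaning `alpha2RowOK_spec`); §3 index descriptions of the rigid sets `Y°`, `Z°`
(a run, a run plus an end point = a longer run, a run plus a point) feeding `coverSearch_of_isSTPP`, and `cover_both_of_isSTPP`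
(the Y-first and the Z-first search are both sound — the kill files use the cheaper one).  Nothing here is progress on `ω`.

References: A. G. Vosper, J. London Math. Soc. 31 (1956); M. B. Nathanson, GTM 165, §2; H. Cohn, R. Kleinberg, B. Szegedy, C. Umans, FOCS 2005
(arXiv:math/0511460), Def. 5.1.
-/

open Finset
open scoped Pointwise

namespace Summit.MatrixMultiplication.OmegaCensus.CubeNB

open Literature.Computability.AlgebraicComplexity
open Literature.Combinatorics.Additive
open Summit.MatrixMultiplication.OmegaCensus.STPPKneser

/-! ## §1 Progressions: complements, one missing point, the two-run value list -/

section AP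

variable {p : ℕ} [hp : Fact p.Prime]

/-- The complement of a `k`-term progression of step `d ≠ 0` in `ℤ/pℤ` is the `(p−k)`-term progression starting right after it. [folklore] -/
theorem sdiff_univ_apFinset {a d : ZMod p} (hd : d ≠ 0) {k : ℕ} (hk : k ≤ p) :
    (univ : Finset (ZMod p)) \ apFinset a d k = apFinset (a + k • d) d (p - k) := by
  set P1 := apFinset a d k with hP1
  set P2 := apFinset (a + k • d) d (p - k) with hP2
  have hunion : P1 ∪ P2 = univ := by
    rw [hP1, hP2, ← apFinset_add_eq_union, Nat.add_sub_cancel' hk]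
    exact apFinset_eq_univ a hd
  have hcard : #P1 + #P2 = p := by
    rw [hP1, hP2, card_apFinset hd hk, card_apFinset hd (Nat.sub_le p k)]
    omega
  have hinter : #(P1 ∩ P2) = 0 := by
    have h := Finset.card_union_add_card_inter P1 P2
    rw [hunion, Finset.card_univ, ZMod.card] at h
    omega
  rw [Finset.card_eq_zero] at hinter
  ext x
  rw [Finset.mem_sdiff]
  constructor
  · rintro ⟨-, hx⟩
    have hxu : x ∈ P1 ∪ P2 := hunion ▸ Finset.mem_univ x
    rcases Finset.mem_union.1 hxu with h | h
    · exact absurd h hx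
    · exact h
  · intro hx
    refine ⟨Finset.mem_univ x, fun h1 => ?_⟩
    have hmem : x ∈ P1 ∩ P2 := Finset.mem_inter.2 ⟨h1, hx⟩
    rw [hinter] at hmem
    simp at hmem

/-- A subset of a finite set with one element fewer misses exactly one point of it. [folklore] -/
theorem exists_eq_sdiff_singleton {α : Type*} [DecidableEq α] {S Q : Finset α} (hsub : S ⊆ Q) (hcard : #Q = #S + 1) :
    ∃ q ∈ Q, q ∉ S ∧ ∀ x, x ∈ S ↔ x ∈ Q ∧ x ≠ q := by
  have h1 : #(Q \ S) = 1 := by rw [Finset.card_sdiff_of_subset hsub]; omega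
  obtain ⟨q, hq⟩ := Finset.card_eq_one.1 h1
  have hqmem : q ∈ Q \ S := by rw [hq]; exact Finset.mem_singleton_self q
  rw [Finset.mem_sdiff] at hqmem
  refine ⟨q, hqmem.1, hqmem.2, fun x => ⟨fun hx => ⟨hsub hx, fun hxq => hqmem.2 (hxq ▸ hx)⟩, fun hx => ?_⟩⟩
  by_contra hxS
  have : x ∈ Q \ S := Finset.mem_sdiff.2 ⟨hx.1, hxS⟩
  rw [hq, Finset.mem_singleton] at this
  exact hx.2 this

/-- **Interior terms of the sum of two one-holed progressions.**  If `Bs` is a `(b+1)`-term progression of step `e′` minus one term and `Vs` an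
`(n+1)`-term one minus one term (`b ≥ 3`, `n ≥ 2`), then every term of index `2 ≤ x ≤ b + n − 2` of the `(b+n+1)`-term progression `β + v + ℕ•e′`
lies in `Bs + Vs` (among three consecutive splits `x = g + (x − g)` at most one uses the hole of `Bs` and at most one the hole of `Vs`). [folklore] -/
theorem mem_add_of_apErase_apErase {β v e' : ZMod p} {b n g h : ℕ} {Bs Vs : Finset (ZMod p)} (hB : Bs = apErase β e' (b + 1) g)
    (hV : Vs = apErase v e' (n + 1) h) (h3b : 3 ≤ b) (h2n : 2 ≤ n) {x : ℕ} (h2x : 2 ≤ x) (hx : x + 2 ≤ b + n) :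
    β + v + x • e' ∈ Bs + Vs := by
  have key : ∃ g', g' ≤ b ∧ g' ≠ g ∧ g' ≤ x ∧ x - g' ≤ n ∧ x - g' ≠ h := by
    by_cases h1 : x - min x n ≠ g ∧ x - (x - min x n) ≠ h
    · exact ⟨x - min x n, by omega, h1.1, by omega, by omega, h1.2⟩
    by_cases h2 : x - min x n + 1 ≠ g ∧ x - (x - min x n + 1) ≠ h
    · exact ⟨x - min x n + 1, by omega, h2.1, by omega, by omega, h2.2⟩
    · exact ⟨x - min x n + 2, by omega, by omega, by omega, by omega, by omega⟩
  obtain ⟨g', hg'b, hg'g, hg'x, hxg'n, hxg'h⟩ := key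
  have hmemB : β + g' • e' ∈ Bs := by rw [hB]; exact mem_apErase.2 ⟨g', by omega, hg'g, rfl⟩
  have hmemV : v + (x - g') • e' ∈ Vs := by rw [hV]; exact mem_apErase.2 ⟨x - g', by omega, hxg'h, rfl⟩
  have heq : β + g' • e' + (v + (x - g') • e') = β + v + x • e' := by
    have hsplit : x • e' = g' • e' + (x - g') • e' := by rw [← add_nsmul, Nat.add_sub_cancel' hg'x]
    rw [hsplit]; abel
  rw [← heq]
  exact Finset.add_mem_add hmemB hmemV

/-- Value list of two `j`-runs of lengths `ℓ₁`, `L − ℓ₁` with offset `δ` (the second run starts at value `δ`). [folklore] -/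
def twoRunVals (p j ℓ₁ δ L : ℕ) : List ℕ :=
  (List.range ℓ₁).map (fun t => (j * t) % p) ++ (List.range (L - ℓ₁)).map (fun t => (δ + j * t) % p)

end AP

/-! ## §2 The case-α₂ row checker with the cover stage (both search orders) -/

section TableTwoCover

/-- The cover test of an α₂ row-shape `(j, ℓ₁, δ)`: the two-stage search in the chosen order — Z-first (`zfirst = true`: Y-points := the `z`-run, Z-points :=
the two-run values, block sizes with `a, b` exchanged) or Y-first. [folklore] -/
def coverA2 (p L z : ℕ) (sAB sBA : List (ℕ × ℕ × ℕ)) (zfirst : Bool) (j ℓ₁ δ : ℕ) : Bool :=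
  if zfirst then coverSearch p (List.range z) (twoRunVals p j ℓ₁ δ L) sBA else coverSearch p (twoRunVals p j ℓ₁ δ L) (List.range z) sAB

/-- Inner loop of the α₂ row checker for fixed `(j, ℓ₁)`, given the lists `T₁`, `T₂` of admissible run starts: every offset `δ = t₂ − t₁` of a pair passing the
prefix test (de-duplicated, so each cover search runs once) must fail its cover test. [folklore] -/
def alpha2RowAux (p L r z : ℕ) (sAB sBA : List (ℕ × ℕ × ℕ)) (zfirst : Bool) (j ℓ₁ : ℕ) (T₁ T₂ : List ℕ) : Bool :=
  ((((T₁ ×ˢ T₂).filter fun tt => prefixOK r ((range (ℓ₁ + 1)).image (fun i => (tt.1 + j * i) % p) ∪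
      (range (L - ℓ₁ + 1)).image (fun i => (tt.2 + j * i) % p))).map fun tt => (tt.2 + p - tt.1) % p).dedup).all fun δ =>
    !(coverA2 p L z sAB sBA zfirst j ℓ₁ δ)

/-- **Case-α₂ row checker with covers** (`Bool`, one `(j, ℓ₁)`): `j` is a target ratio, or every window/prefix-admissible pair `(t₁, t₂)` has a failed cover
search for its offset. [folklore] -/
def alpha2RowOK (p n₁ L r : ℕ) (J : Finset ℕ) (z : ℕ) (sAB sBA : List (ℕ × ℕ × ℕ)) (zfirst : Bool) (j ℓ₁ : ℕ) : Bool :=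
  decide (j ∈ J) || alpha2RowAux p L r z sAB sBA zfirst j ℓ₁
    ((List.range p).filter fun t₁ => (List.range (ℓ₁ + 1)).all fun i => decide ((t₁ + j * i) % p < n₁))
    ((List.range p).filter fun t₂ => (List.range (L - ℓ₁ + 1)).all fun i => decide ((t₂ + j * i) % p < n₁))

/-- **Meaning of the α₂ row checker.** [folklore] -/
theorem alpha2RowOK_spec {p n₁ L r : ℕ} {J : Finset ℕ} {z : ℕ} {sAB sBA : List (ℕ × ℕ × ℕ)} {zfirst : Bool} {j ℓ₁ : ℕ}
    (h : alpha2RowOK p n₁ L r J z sAB sBA zfirst j ℓ₁ = true) :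
    ∀ t₁ < p, ∀ t₂ < p, (∀ i < ℓ₁ + 1, (t₁ + j * i) % p < n₁) → (∀ i < L - ℓ₁ + 1, (t₂ + j * i) % p < n₁) →
      prefixOK r ((range (ℓ₁ + 1)).image (fun i => (t₁ + j * i) % p) ∪ (range (L - ℓ₁ + 1)).image (fun i => (t₂ + j * i) % p)) = true →
      j ∈ J ∨ coverA2 p L z sAB sBA zfirst j ℓ₁ ((t₂ + p - t₁) % p) = false := by
  intro t₁ ht₁ t₂ ht₂ hw1 hw2 hpre
  rw [alpha2RowOK, Bool.or_eq_true, decide_eq_true_eq] at h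
  rcases h with hJ | h
  · exact Or.inl hJ
  right
  rw [alpha2RowAux, List.all_eq_true] at h
  have hT₁ : t₁ ∈ (List.range p).filter fun t₁ => (List.range (ℓ₁ + 1)).all fun i => decide ((t₁ + j * i) % p < n₁) := by
    rw [List.mem_filter, List.mem_range, List.all_eq_true]
    exact ⟨ht₁, fun i hi => decide_eq_true (hw1 i (List.mem_range.1 hi))⟩
  have hT₂ : t₂ ∈ (List.range p).filter fun t₂ => (List.range (L - ℓ₁ + 1)).all fun i => decide ((t₂ + j * i) % p < n₁) := by
    rw [List.mem_filter, List.mem_range, List.all_eq_true]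
    exact ⟨ht₂, fun i hi => decide_eq_true (hw2 i (List.mem_range.1 hi))⟩
  have hmem := h ((t₂ + p - t₁) % p) (List.mem_dedup.2 (List.mem_map.2 ⟨(t₁, t₂), List.mem_filter.2 ⟨List.pair_mem_product.2 ⟨hT₁, hT₂⟩, hpre⟩, rfl⟩))
  rwa [Bool.not_eq_true'] at hmem

end TableTwoCover

/-! ## §3 Index descriptions of the rigid sets -/

section Indices

variable {p : ℕ} [hp : Fact p.Prime]

/-- Values of an `L`-term progression `Yo = y₀ + d·[0,L)` relative to `y₀`: exactly the members of `[((u d).val·t) mod p : t < L]`. [folklore] -/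
theorem vals_of_apFinset_eq (u : ZMod p) {y₀ d : ZMod p} {L : ℕ} {Yo : Finset (ZMod p)} (hy : Yo = apFinset y₀ d L) :
    (∀ x ∈ Yo, (u * (x - y₀)).val ∈ (List.range L).map fun t => ((u * d).val * t) % p) ∧
      ∀ t' ∈ (List.range L).map (fun t => ((u * d).val * t) % p), ∃ x ∈ Yo, (u * (x - y₀)).val = t' := by
  refine vals_of_indices u y₀ d (List.range L) Yo (fun x hx => ?_) (fun t ht => ?_)
  · rw [hy, mem_apFinset] at hx
    obtain ⟨t, ht, rfl⟩ := hx
    exact ⟨t, List.mem_range.2 ht, rfl⟩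
  · rw [hy]; exact mem_apFinset.2 ⟨t, List.mem_range.1 ht, rfl⟩

/-- Values of a `z`-run `Zo = z₀ + e′·[0,z)` (`u e′ = 1`, `z ≤ p`) relative to `z₀`: exactly the members of `[0, z)`. [folklore] -/
theorem vals_of_apFinset_eq_one {u e' : ZMod p} (hue : u * e' = 1) {z₀ : ZMod p} {z : ℕ} (hz : z ≤ p) {Zo : Finset (ZMod p)}
    (hZ : Zo = apFinset z₀ e' z) :
    (∀ x ∈ Zo, (u * (x - z₀)).val ∈ List.range z) ∧ ∀ t ∈ List.range z, ∃ x ∈ Zo, (u * (x - z₀)).val = t := by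
  refine vals_of_indices_one hue z₀ (List.range z) (fun t ht => by rw [List.mem_range] at ht; omega) Zo (fun x hx => ?_) (fun t ht => ?_)
  · rw [hZ, mem_apFinset] at hx
    obtain ⟨t, ht, rfl⟩ := hx
    exact ⟨t, List.mem_range.2 ht, rfl⟩
  · rw [hZ]; exact mem_apFinset.2 ⟨t, List.mem_range.1 ht, rfl⟩

/-- **A `(z−1)`-run plus an END point is a `z`-run.**  If `Zo` consists of the run `z₀ + e′·[0, z−1)` and the point `q = z₀ + (k + z − 1)•e′` with `k = 0`
(the next term) or `k = c` where `z + c = p` (the previous term, cyclically), then `Zo` is described by the indices `[0, z)` from a suitable base. [folklore] -/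
theorem exists_run_indices {e' z₀ q : ZMod p} {Zo : Finset (ZMod p)} {z k c : ℕ} (hzc : z + c = p) (hz : 1 ≤ z) (hk : k = 0 ∨ k = c)
    (hqz : q = z₀ + (k + z - 1) • e') (hqZo : q ∈ Zo) (hZoQ : ∀ x ∈ Zo, x ≠ q → x ∈ apFinset z₀ e' (z - 1))
    (hQZo : ∀ x ∈ apFinset z₀ e' (z - 1), x ∈ Zo) :
    ∃ z₁ : ZMod p, (∀ x ∈ Zo, ∃ t ∈ List.range z, x = z₁ + t • e') ∧ ∀ t ∈ List.range z, z₁ + t • e' ∈ Zo := by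
  have hpe : (p : ℕ) • e' = 0 := by rw [nsmul_eq_mul, ZMod.natCast_self, zero_mul]
  rcases hk with rfl | hkc
  · -- k = 0: base z₀, q is the last term
    refine ⟨z₀, fun x hx => ?_, fun t ht => ?_⟩
    · by_cases hxq : x = q
      · exact ⟨z - 1, List.mem_range.2 (by omega), by rw [hxq, hqz, show 0 + z - 1 = z - 1 by omega]⟩
      · obtain ⟨t, ht, rfl⟩ := mem_apFinset.1 (hZoQ x hx hxq)
        exact ⟨t, List.mem_range.2 (by omega), rfl⟩
    · rw [List.mem_range] at ht
      rcases Nat.lt_or_ge t (z - 1) with htz | htz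
      · exact hQZo _ (mem_apFinset.2 ⟨t, htz, rfl⟩)
      · have htz' : t = 0 + z - 1 := by omega
        rw [htz', ← hqz]; exact hqZo
  · -- k = c: base q = z₀ − e′
    have hshift : ∀ t : ℕ, q + (t + 1) • e' = z₀ + t • e' := fun t => by
      rw [hqz, hkc, add_assoc, ← add_nsmul, show c + z - 1 + (t + 1) = p + t by omega, add_nsmul, hpe, zero_add]
    refine ⟨q, fun x hx => ?_, fun t ht => ?_⟩
    · by_cases hxq : x = q
      · exact ⟨0, List.mem_range.2 (by omega), by rw [hxq, zero_nsmul, add_zero]⟩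
      · obtain ⟨t, ht, rfl⟩ := mem_apFinset.1 (hZoQ x hx hxq)
        exact ⟨t + 1, List.mem_range.2 (by omega), (hshift t).symm⟩
    · rw [List.mem_range] at ht
      rcases Nat.eq_zero_or_pos t with rfl | htpos
      · rw [zero_nsmul, add_zero]; exact hqZo
      · have heq : q + t • e' = z₀ + (t - 1) • e' := by
          have h1 := hshift (t - 1)
          rwa [Nat.sub_add_cancel htpos] at h1
        rw [heq]
        exact hQZo _ (mem_apFinset.2 ⟨t - 1, by omega, rfl⟩)

/-- **A `(z−1)`-run plus a point**: `Zo` = the run `z₀ + e′·[0, z−1)` together with `q = z₀ + (k + z − 1)•e′` is described from the base `z₀` by the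
indices `[0, z−1) ++ [k + z − 1]`. [folklore] -/
theorem exists_point_indices {e' z₀ q : ZMod p} {Zo : Finset (ZMod p)} {z k : ℕ}
    (hqz : q = z₀ + (k + z - 1) • e') (hqZo : q ∈ Zo) (hZoQ : ∀ x ∈ Zo, x ≠ q → x ∈ apFinset z₀ e' (z - 1))
    (hQZo : ∀ x ∈ apFinset z₀ e' (z - 1), x ∈ Zo) :
    (∀ x ∈ Zo, ∃ t ∈ List.range (z - 1) ++ [k + z - 1], x = z₀ + t • e') ∧ ∀ t ∈ List.range (z - 1) ++ [k + z - 1], z₀ + t • e' ∈ Zo := by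
  refine ⟨fun x hx => ?_, fun t ht => ?_⟩
  · by_cases hxq : x = q
    · exact ⟨k + z - 1, List.mem_append.2 (Or.inr (List.mem_singleton.2 rfl)), by rw [hxq, hqz]⟩
    · obtain ⟨t, ht, rfl⟩ := mem_apFinset.1 (hZoQ x hx hxq)
      exact ⟨t, List.mem_append.2 (Or.inl (List.mem_range.2 ht)), rfl⟩
  · rw [List.mem_append, List.mem_singleton] at ht
    rcases ht with ht | rfl
    · exact hQZo _ (mem_apFinset.2 ⟨t, List.mem_range.1 ht, rfl⟩)
    · rw [← hqz]; exact hqZo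

/-- **Both search orders are sound.**  Under the hypotheses of `coverSearch_of_isSTPP` the Y-first search AND the Z-first search (the same family read as
`(B, A, C)` — `isSTPP_swapBC (stpp_rotate hS)` — with the roles of the two rigid sets exchanged) return `true`. [cite: CohnKleinbergSzegedyUmans2005, Def. 5.1] -/
theorem cover_both_of_isSTPP {N : ℕ} {A B C : Fin N → Finset (ZMod p)} (hS : IsSTPP A B C) (hA : ∀ k, (A k).Nonempty) (hB : ∀ k, (B k).Nonempty)
    (hC : ∀ k, (C k).Nonempty) (i : Fin N) (ks : List (Fin N)) (hks : ks.Nodup) (hksi : ∀ k, k ∈ ks ↔ k ≠ i) {u y₀ z₀ : ZMod p} (hu0 : u ≠ 0)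
    {YL ZL : List ℕ}
    (hY1 : ∀ x ∈ DU B C (univ.erase i), (u * (x - y₀)).val ∈ YL) (hY2 : ∀ t ∈ YL, ∃ x ∈ DU B C (univ.erase i), (u * (x - y₀)).val = t)
    (hZ1 : ∀ x ∈ DU A C (univ.erase i), (u * (x - z₀)).val ∈ ZL) (hZ2 : ∀ t ∈ ZL, ∃ x ∈ DU A C (univ.erase i), (u * (x - z₀)).val = t) :
    coverSearch p YL ZL (ks.map fun k => (#(A k), #(B k), #(C k))) = true ∧
      coverSearch p ZL YL (ks.map fun k => (#(B k), #(A k), #(C k))) = true :=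
  ⟨coverSearch_of_isSTPP hS hA hB hC i ks hks hksi hu0 hY1 hY2 hZ1 hZ2,
    coverSearch_of_isSTPP (STPP222SqNeg.isSTPP_swapBC (stpp_rotate hS)) hB hA hC i ks hks hksi hu0 hZ1 hZ2 hY1 hY2⟩

end Indices

end Summit.MatrixMultiplication.OmegaCensus.CubeNB
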